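import Summits.ResolutionOfSingularities.ResolutionOfSingularities.Theorems.HilbertSamuelEliminationSigmaMaxModificationsCorridor3WLadderShadowMDefs
import Summits.ResolutionOfSingularities.ResolutionOfSingularities.Theorems.HilbertSamuelEliminationSigmaMaxModificationsCorridor3WLadderMovingIsoDefs
import Literature.Combinatorics.HironakaPolyhedraGame.Spivakovsky1983
import HarnessLib

/-!
# [OURS · L1 W4.2] MODULE `Corridor3WLadderForcedGameTowers` (crux chain w42, idea-1 ROUND 5 card C4 `forced-hironaka-game-iso-vertices`)
# — part 1/2: the DEFINITIONS (Hironaka's polyhedra game in Spivakovsky's rules and the FORCED game; origin-chart chains; vertex-chained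
# tails of isolated point towers; the rows P1 / P2 / T2 / T3 of the card)

PROVENANCE / SPLIT FOR THE GATE (typer res-type-012; res-L1-w42-plan-1 «W4.2 DEAL» 2026-08-27T07:34:07Z, D2 «C4 TOWER LAYER»):
the two tree modules `…Corridor3WLadderForcedGameTowersDefs` (this file: definitions, in idea-1's order) and
`…Corridor3WLadderForcedGameTowers` (the PROVED lemmas and assemblies) land §§1–4 of res-L1-w42-idea-1's (gen 5)
`HOME/L/res-L1-w42-idea-1/Sketch-L1-idea-1-C4.lean` (sha16 `08c84fc33d6000e7`, 412 l.; farm `lean check` rc 0 · 0 errors · 0 sorries,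
re-checked against the tree of 2026-08-27T07:29Z) in the SAME namespace `…Cruxes.SigmaMaxModifications.IdeasL1C4`, written against the
LANDED `…Corridor3WLadderShadowMDefs` (res-type-067, p501775: `genPoints`, `shadowMoveT`) and `…Corridor3WLadderMovingIsoDefs`
(res-type-012, p500943: `IsIsoPointTower`, `IsoQuadraticTowerTerminates`) — nothing of them is re-declared.  §5 `LabelBoundAlongLineage`
is NOT here (DEAL D1, res-type-040's `…Corridor3WLadderStrataLabelBound`).  Differences from the sketch: (i) definitions hoisted into
this `…Defs` module, lemmas/assemblies into part 2/2; (ii) THREE RETYPINGS ruled by the DEAL (D2) after res-D-pv-010's FINDING #2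
(2026-08-27T07:31:04Z, junk witness `S = k`, `u = 0`, `h = X^m` against P1 as first typed): `AlgIsolatedOfIsolated` (P1) is stated over
the frame of `ShadowM.Reads` — `S` REGULAR local of dimension `3` with `(u) = 𝔪_S`, the non-zero-divisor clause `H`, and `Y` EXCELLENT;
`HasVertexChainedTail` carries the same frame for its rings `S_k` (in place of «noetherian local, `u_k ∈ 𝔪`»); `IsoVertexTowersImpossible`
(T2) assumes the first stage excellent; and P1's level is PINNED to `3` (res-L1-w42-tri-2 TRIAGE v5.2 (3) / re-cut 07:48:01Z,
res-L1-w42-plan-1 RE-CUT OF RECORD 07:49:38Z) — each retyped docstring says so; every other declaration is BYTE-IDENTICAL to the sketch;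
(iii) the sketch's `import Literature.AlgebraicGeometry.Resolution.CharPolyhedronOriginChart` is not needed by the definitions and moves
to the consumers.  (iv) the printed game vocabulary of §1 — `IsPosition`, `IsPermissible`, `Won`, `gameMove`, `play` — and idea-1's
`SpivakovskyWinningStrategy d` are NOT declared here: they are IMPORTED BY NAME from DEAL D4's Literature module
`Literature.Combinatorics.HironakaPolyhedraGame.Spivakovsky1983` (res-type-004), whose bodies are the sketch's and whose `PositionalWin d` IS
`SpivakovskyWinningStrategy d` literally (the named fact there is `Spivakovsky1983_winningStrategy : ∀ n, PositionalWin n`); so §1 keeps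
only the OURS notions `IsIsoAdmissible`, `forcedMove`, `ForcedGameTerminates`, and part 2/2 takes `(h : PositionalWin d)` where the sketch
took `(h : SpivakovskyWinningStrategy d)` — nothing here claims or proves Spivakovsky's theorem.  All `def`s below are
`Prop`-valued OURS rows / carriers of the w42 chain (helper VOCABULARY, counted 0; card C4 is not yet triaged, no skeleton registration);
cited works appear as POINTERS only; NOT statements of [CossartJannsenSaito2020], [CossartPiltant2019], [Spivakovsky1983] nor of the
manuscript [Hironaka2017] under review in the cell; they assert nothing.  (v) Bibliographic correction (res-L1-w42-tri-2 TRIAGE v5.2 (1)):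
the rules and the theorem are printed in M. Artin, J. Tate (eds.), Arithmetic and Geometry II, Progr. Math. 36 (Birkhäuser 1983),
pp. 419–432 [Spivakovsky1983] — not in «Shafarevich (ed.), Algebraic Geometry II (Enc. Math. Sci. 35)» as idea-1's docstring below has it.
AI typing, weaker than expert review.  idea-1's module docstring follows unchanged.
-/

/-!
# [OURS · L1 W4.2] Sketch-L1-idea-1 — ROUND 5 (gen 5), card C4 «FORCED HIRONAKA GAME AT ISOLATED VERTICES»

Crux `SigmaMaxModifications` (stmt-…-18506), attacked conjunct `…Corridor3` (stmt-…-19249), open core kernel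
`IdeasL1Idea2R4.IsoQuadraticTowerTerminates p 3` (tree `…Corridor3WLadderMovingIsoDefs`, p500943).

THE LEVER.  Along an isolated E3 point tower the pair of facts
  (ISO)  the centre is ISOLATED in the Hilbert–Samuel maximal locus  ⟹  no coordinate curve `V(Z, u_a, u_b)` lies in the
         top locus  ⟹  for every pair `{a, b}` the characteristic polyhedron `Δ(h; u; Z)` has a generating point with
         `x_a + x_b < 1`  ⟹  NO proper subset `Γ ⊊ {1,2,3}` is permissible in Hironaka's polyhedra game, and
  (NEAR) the next point is near (`δ(Δ) ≥ 1`)  ⟹  `Γ = {1,2,3}` IS permissible,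
make `Γ = {1,2,3}` the UNIQUE permissible move of player A in Hironaka's ORIGINAL polyhedra game [Spivakovsky 1983,
«A solution to Hironaka's polyhedra game»; rules as printed in Shafarevich (ed.), Algebraic Geometry II, pp. 419–420:
A picks a permissible `Γ` (`Σ_{j∈Γ} x_j ≥ 1` on `Δ`), B picks `i ∈ Γ`, `x_i' = Σ_{j∈Γ} x_j − 1`; A wins when `Δ` acquires a
point with `Σ x_j ≤ 1`; THEOREM (Spivakovsky): A has a winning strategy, positional (Remark 1)].  A play in which A's move is
forced at every stage is consistent with EVERY strategy of A, in particular with the winning one — so it is FINITE.  Hence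
(§1, PROVED below from the typed Spivakovsky fact) the FORCED GAME TERMINATES: there is no infinite sequence of generator sets
`A_{k+1} = σ_{univ,i_k}(A_k)` all iso-admissible.  With the tree's Cossart–Piltant Prop. 2.6 (origin-chart transform law
`Δ' = l(Δ)` = `σ_{univ,j₀}`, `Literature.AlgebraicGeometry.Resolution.CossartPiltant.minExponents_of_mul_pow_eq`, PROVED) this
closes the VERTEX-RECURRENT case of the kernel (§2–§3): an iso point tower whose later centres are all chart ORIGINS of one
propagated regular frame with `δ > 1` throughout cannot exist — characteristic-free, directrix-free, maximal-contact-free.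
What is left of the kernel is the TRANSLATION-RECURRENT case (§4, the honest residual: Moh / Hauser-kangaroo / Cossart–Piltant
territory) and the `δ = 1` (inseparable-initial-form) events, rowed separately in the cell (`Wtop3InsepRecM`).

NOT a statement of the manuscript [Hironaka2017] under review; everything here is OURS; Spivakovsky's theorem is TYPED here as a
candidate named fact for the FACT desk (§1 `SpivakovskyWinningStrategy`), used only as a hypothesis BY NAME.  AI typing,
weaker than expert review.
-/

set_option linter.dupNamespace false
set_option autoImplicit false

noncomputable section

open Polynomial Finset
open scoped BigOperators

namespace Summit.ResolutionOfSingularities.ResolutionOfSingularities.Cruxes.SigmaMaxModifications.IdeasL1C4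

open Summit.ResolutionOfSingularities.ResolutionOfSingularities.Theorems.CampaignW42
open Summit.ResolutionOfSingularities.ResolutionOfSingularities.Theses.HilbertSamuelElimination
open Summit.ResolutionOfSingularities.ResolutionOfSingularities.Theorems.SigmaMaxModificationsCorridor3
open Summit.ResolutionOfSingularities.ResolutionOfSingularities.Theorems.SigmaMaxModificationsCorridor3.Moving
open Summit.ResolutionOfSingularities.ResolutionOfSingularities.Theorems.SigmaMaxModificationsCorridor3.ShadowM
open Summit.ResolutionOfSingularities.ResolutionOfSingularities.Cruxes.SigmaMaxModifications.IdeasL1Idea2R4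
open Literature.AlgebraicGeometry.Resolution.CossartPiltant

open Literature.Combinatorics.HironakaPolyhedraGame

/-! ## §1. Hironaka's polyhedra game (Spivakovsky's rules) and the FORCED game -/

section Game

variable {d : ℕ}

/-- [OURS] An ISO-ADMISSIBLE position: a position with `δ > 1` (every generator has `|a| > 1`, i.e. not won and the next point
near after the move) in which NO nonempty proper `Γ` is permissible (the PAIR CONDITION forced by isolation: for each pair
`{a,b}` — and a fortiori each singleton — some generator has `x_a + x_b < 1`). [folklore] -/
def IsIsoAdmissible (A : Finset (Fin d → ℚ)) : Prop :=
  IsPosition A ∧ (∀ a ∈ A, (1 : ℚ) < ∑ j, a j) ∧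
    ∀ Γ : Finset (Fin d), Γ.Nonempty → Γ ≠ Finset.univ → ¬ IsPermissible A Γ

/-- The FORCED move `σ_{univ,i}` (`x_i ↦ |x| − 1`): for `d = 3` it is the tree's `ShadowM.shadowMoveT univ ∅ i`
(`forcedMove_eq_shadowMoveT`, part 2/2). [folklore] -/
def forcedMove (i : Fin d) : (Fin d → ℚ) → (Fin d → ℚ) :=
  gameMove Finset.univ i

/-- [OURS · the combinatorial heart of C4] **THE FORCED POLYHEDRA GAME TERMINATES** (`CL`): there is no infinite sequence of
generator sets, each the forced transform `σ_{univ,i_k}` of the previous one, all iso-admissible.  PROVED in part 2/2 from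
`PositionalWin d` (Literature, DEAL D4; = idea-1's `SpivakovskyWinningStrategy d`) (`forcedGameTerminates_of_spivakovsky`); ALSO checked exhaustively/at random in-seat for
`d = 3` (all 37 100 iso-admissible generator sets of ≤ 3 points with coordinates in `(1/3)ℕ ≤ 3`: longest forced play 6, no
cycle; 60 000+ random admissible starts with denominators ≤ 10: longest play 70, no repeat of a normalised position) — a
direct potential proof is open only in the «three charts infinitely often» case (§1c). [folklore] -/
def ForcedGameTerminates (d : ℕ) : Prop :=
  ∀ (A : ℕ → Finset (Fin d → ℚ)) (i : ℕ → Fin d),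
    (∀ n, A (n + 1) = (A n).image (forcedMove (i n))) → ¬ ∀ n, IsIsoAdmissible (A n)

end Game

/-! ## §2. Origin-chart chains of hypersurface data: the VERTEX-RECURRENT case is the forced game (T2, algebraic form)

An ORIGIN-CHART CHAIN is a sequence `(S_k, u_k, h_k)` (noetherian local `S_k`, a frame `u_k : Fin 3 → S_k`, `h_k ∈ S_k[X]`)
linked by ring maps `ψ_k : S_k → S_{k+1}` satisfying EXACTLY the abstract chart hypotheses of the tree's Cossart–Piltant
Prop. 2.6 section (`Literature.AlgebraicGeometry.Resolution.CossartPiltant`, `CharPolyhedronOriginChart.lean`, hypotheses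
`H hu H' hj₀ hnzd hrel hψ hdeg hcoef` with `J = univ`): `u_j ↦ u'_{j₀} u'_j (j ≠ j₀)`, `u_{j₀} ↦ u'_{j₀}`, and the strict
transform relation `h'_{m−i} · u'_{j₀}^i = ψ(h_{m−i})`.  By `minExponents_of_mul_pow_eq` (PROVED in the tree) the generating
points transform by the forced move up to domination: `genPoints u' h' ⊆ σ_{univ,j₀}(genPoints u h)` and every point of
`σ_{univ,j₀}(genPoints u h)` dominates one of `genPoints u' h'`; iso-admissibility is domination-invariant; so an origin-chart
chain all of whose polyhedra are iso-admissible sandwiches an infinite forced play — impossible by `ForcedGameTerminates 3`. -/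

section Chain

/-- [OURS · C4 · T2 algebraic] **NO ISO-ADMISSIBLE ORIGIN-CHART CHAIN**: there is no infinite origin-chart chain of hypersurface
data whose characteristic polyhedra are iso-admissible at every stage.  Size M given `ForcedGameTerminates 3` (the domination
sandwich above; ingredients `CossartPiltant.minExponents_of_mul_pow_eq`, `genPoints`).  Why it might fail: only mis-typing of
the sandwich (the `ℕ`-subtraction in `l₀(a) − i e_{j₀}` is safe because admissibility gives `i < |a|`).  OURS node (cf. Cossart–Piltant 2019, Prop. 2.6, for the chart law); not a citation of print;
not asserted. [OURS · L1 W4.2; AI-written] -/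
def IsoVertexChainImpossible : Prop :=
  ∀ (S : ℕ → Type) [∀ k, CommRing (S k)] [∀ k, IsNoetherianRing (S k)] [∀ k, IsLocalRing (S k)]
    (u : ∀ k, Fin 3 → S k) (h : ∀ k, (S k)[X]) (j₀ : ℕ → Fin 3) (ψ : ∀ k, S k →+* S (k + 1)),
    (∀ k (i : Fin 3) (T : Finset (Fin 3)), i ∉ T →
      ∀ y, u k i * y ∈ Ideal.span (u k '' ↑T) → y ∈ Ideal.span (u k '' ↑T)) →
    (∀ k i, u k i ∈ IsLocalRing.maximalIdeal (S k)) →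
    (∀ k (y : S (k + 1)), u (k + 1) (j₀ k) * y = 0 → y = 0) →
    (∀ k j, ψ k (u k j) =
      if j ∈ (Finset.univ : Finset (Fin 3)) ∧ j ≠ j₀ k then u (k + 1) (j₀ k) * u (k + 1) j else u (k + 1) j) →
    (∀ k (γ : S k), ψ k γ ∈ Ideal.span (Set.range (u (k + 1))) → γ ∈ Ideal.span (Set.range (u k))) →
    (∀ k, (h (k + 1)).natDegree = (h k).natDegree) →
    (∀ k, ∀ i ∈ Finset.Icc 1 (h k).natDegree,
      (h (k + 1)).coeff ((h k).natDegree - i) * u (k + 1) (j₀ k) ^ i = ψ k ((h k).coeff ((h k).natDegree - i))) →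
    ¬ ∀ k, IsIsoAdmissible (genPoints (u k) (h k))

/-- [OURS · C4 · P2, pure commutative algebra] **ALGEBRAIC ISOLATION ⇒ PAIR CONDITION.**  `h ∈ S[X]` monic of degree `m` over a
noetherian local `S` with frame `u`; if for NO pair `a ≠ b` the coordinate curve ideal `(X, u_a, u_b)` satisfies
`h ∈ (X, u_a, u_b)^m` (i.e. no coordinate curve lies in the multiplicity-`m` locus), then for every pair some generating point
of `Δ(h; u; X)` has `x_a + x_b < 1` (⇔ `h_{m−i} ∉ (u_a, u_b)^i` for some `i`, by `CossartPiltant.minExponents_spec'`).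
Size S–M.  Why it might fail: only if `minExponents` mis-reads membership in `(u_a,u_b)^i` for a non-regular frame — state it
with the tree's hypothesis `H` (the frame is a regular system of parameters).  OURS node (cf. Cossart–Piltant 2019, Def. 2.3, for
`Δ(h; u; X)`); not a citation of print; not asserted. [OURS · L1 W4.2; AI-written] -/
def PairConditionOfAlgIsolated : Prop :=
  ∀ (S : Type) [CommRing S] [IsNoetherianRing S] [IsLocalRing S] (u : Fin 3 → S) (h : S[X]),
    (∀ (i : Fin 3) (T : Finset (Fin 3)), i ∉ T → ∀ y, u i * y ∈ Ideal.span (u '' ↑T) → y ∈ Ideal.span (u '' ↑T)) →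
    (∀ i, u i ∈ IsLocalRing.maximalIdeal S) → h.Monic →
    (∀ a b : Fin 3, a ≠ b →
      h ∉ (Ideal.span ({X, C (u a), C (u b)} : Set S[X])) ^ h.natDegree) →
    ∀ a b : Fin 3, a ≠ b → ∃ g ∈ genPoints u h, g a + g b < 1

end Chain

/-! ## §3. The geometric side: VERTEX-CHAINED TAILS of a point tower, isolation transfer (P1), and T2 -/

section Towers

open CategoryTheory AlgebraicGeometry TopologicalSpace
open Literature.AlgebraicGeometry.CossartJannsenSaito2020 Literature.AlgebraicGeometry.Resolution

universe u

/-- [OURS · C4] **A VERTEX-CHAINED TAIL** of a point tower `(T, pt)` from stage `n₀`: presentations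
`φ_k : 𝒪_{X_{n₀+k}, pt_{n₀+k}} → S_k[X]/(h_k)` (flat local, maximal ideal to maximal ideal, residue-surjective — the tree's
`ShadowM.Presents` clauses) of hypersurface data `(S_k, u_k, h_k)` forming an ORIGIN-CHART CHAIN (§2) whose steps are
COMPATIBLE with the blow-up maps (`χ_k ∘ φ_k = φ_{k+1} ∘ π^*` on stalks, `χ_k` the map of quotients induced by `ψ_k` and
`X ↦ u'_{j₀} X`), with `δ > 1` along the tail (every generating point has `|x| > 1`: the separable regime).  Informally:
«from `n₀` on, every centre is the ORIGIN of a chart of one propagated regular frame, and the initial form never becomes a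
`p`-th power in that frame».  RETYPED at landing (res-L1-w42-plan-1 W4.2 DEAL 2026-08-27T07:34:07Z D2, res-D-pv-010 FINDING #2
07:31:04Z): the rings `S_k` are REGULAR local of dimension `3` with `(u_k) = 𝔪_{S_k}` — the frame of `ShadowM.Reads` — in place of
«noetherian local with `u_k ∈ 𝔪`» (which `(u_k) = 𝔪_{S_k}` implies), so that the retyped P1 `AlgIsolatedOfIsolated` applies along
the tail; every other clause is idea-1's VERBATIM.  NOT a statement of any manuscript. [cite: CossartPiltant2019, Prop. 2.6 (pointer)] -/
def HasVertexChainedTail (T : BlowupTower.{u}) (pt : ∀ n, T.X n) : Prop :=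
  ∃ (n₀ : ℕ) (S : ℕ → Type) (_ : ∀ k, CommRing (S k)) (_ : ∀ k, IsRegularLocalRing (S k))
    (u : ∀ k, Fin 3 → S k) (h : ∀ k, (S k)[X]) (_ : ∀ k, IsLocalRing ((S k)[X] ⧸ Ideal.span {h k}))
    (φ : ∀ k, ((T.X (n₀ + k)).presheaf.stalk (pt (n₀ + k)) : Type u) →+* (S k)[X] ⧸ Ideal.span {h k})
    (j₀ : ℕ → Fin 3) (ψ : ∀ k, S k →+* S (k + 1))
    (χ : ∀ k, ((S k)[X] ⧸ Ideal.span {h k}) →+* ((S (k + 1))[X] ⧸ Ideal.span {h (k + 1)})),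
    -- presentations (the `Presents` clauses, letI the local instances)
    (∀ k, IsLocalHom (φ k) ∧ (φ k).Flat ∧
      Ideal.map (φ k) (IsLocalRing.maximalIdeal _) = IsLocalRing.maximalIdeal _ ∧
      Function.Surjective ((IsLocalRing.residue _).comp (φ k))) ∧
    -- hypersurface data: the frame hypothesis `H` of the origin-chart chain (§2), monic equation
    (∀ k (i : Fin 3) (T : Finset (Fin 3)), i ∉ T →
      ∀ y, u k i * y ∈ Ideal.span (u k '' ↑T) → y ∈ Ideal.span (u k '' ↑T)) ∧
    -- the frame of `ShadowM.Reads`: `S_k` regular local of dimension `3` with regular system of parameters `u_k`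
    (∀ k, ringKrullDim (S k) = 3 ∧ Ideal.span (Set.range (u k)) = IsLocalRing.maximalIdeal (S k)) ∧
    (∀ k, (h k).Monic) ∧
    -- origin-chart chain (CP Prop. 2.6 hypotheses, `J = univ`)
    (∀ k (y : S (k + 1)), u (k + 1) (j₀ k) * y = 0 → y = 0) ∧
    (∀ k j, ψ k (u k j) =
      if j ∈ (Finset.univ : Finset (Fin 3)) ∧ j ≠ j₀ k then u (k + 1) (j₀ k) * u (k + 1) j else u (k + 1) j) ∧
    (∀ k (γ : S k), ψ k γ ∈ Ideal.span (Set.range (u (k + 1))) → γ ∈ Ideal.span (Set.range (u k))) ∧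
    (∀ k, (h (k + 1)).natDegree = (h k).natDegree) ∧
    (∀ k, ∀ i ∈ Finset.Icc 1 (h k).natDegree,
      (h (k + 1)).coeff ((h k).natDegree - i) * u (k + 1) (j₀ k) ^ i = ψ k ((h k).coeff ((h k).natDegree - i))) ∧
    -- `χ_k` is induced by `ψ_k` on coefficients and `X ↦ u'_{j₀} · X`
    (∀ k (s : S k), χ k (Ideal.Quotient.mk _ (C s)) = Ideal.Quotient.mk _ (C (ψ k s))) ∧
    (∀ k, χ k (Ideal.Quotient.mk _ X) = Ideal.Quotient.mk _ (C (u (k + 1) (j₀ k)) * X)) ∧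
    -- compatibility with the blow-up maps on stalks (`π (pt_{n₀+k+1}) = pt_{n₀+k}` transported by `stalkCongr`)
    (∀ k, ∃ hb : (T.π (n₀ + k)).base (pt (n₀ + k + 1)) = pt (n₀ + k),
      (φ (k + 1)).comp ((T.π (n₀ + k)).stalkMap (pt (n₀ + k + 1))).hom =
        (χ k).comp ((φ k).comp ((T.X (n₀ + k)).presheaf.stalkCongr (.of_eq hb)).hom.hom)) ∧
    -- `δ > 1` along the tail
    (∀ k, ∀ g ∈ genPoints (u k) (h k), (1 : ℚ) < ∑ j, g j)


/-- [OURS · C4 · P1, the geometric-to-algebraic isolation transfer — RETYPED at landing] **ISOLATED ⇒ ALGEBRAICALLY ISOLATED**: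
if `y` is isolated in the LEVEL-`3` Hilbert–Samuel maximal locus of a locally noetherian EXCELLENT scheme `Y` and `φ : 𝒪_{Y,y} → S[X]/(h)` is a
presentation (flat local, `𝔪 ↦ 𝔪`, residue-surjective) by a monic `h` over a REGULAR local ring `S` of dimension `3` whose maximal
ideal is generated by the frame `u` (the frame of `ShadowM.Reads`; the non-zero-divisor clause `H` of the origin-chart chain is carried
too), then no coordinate curve lies in the multiplicity-`m` locus: `h ∉ (X, u_a, u_b)^m` for `a ≠ b`, `m = deg h`.  RETYPING
(res-L1-w42-plan-1 W4.2 DEAL 2026-08-27T07:34:07Z D2 ← res-D-pv-010 FINDING #2 07:31:04Z): idea-1's original quantified over ANY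
noetherian local `S` with `u_i ∈ 𝔪_S` and no excellence, and is refuted by the degenerate frame `S = k`, `u = 0`, `h = X^m`,
`Y = Spec k[X]/(X^m)` (one point, trivially isolated; conclusion `X^m ∉ (X)^m` false), and res-L1-w42-tri-2's TRIAGE v5.2 (07:43:12Z,
kernel `Tri2R5C4.not_algIsolatedOfIsolated` + paper witnesses W2 «regular 3-frame, `h = X² + u₁u₂`, LEVEL `N = 0`» and W3 «`S` regular of
dimension 4 ⊋ frame») shows the repair needs BOTH the regular 3-frame AND the level pinned to the dimension: the LEVEL IS PINNED TO `3` = `dim S` =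
`dim 𝒪_{Y,y}` (res-L1-w42-plan-1 RE-CUT OF RECORD 07:49:38Z = tri-2's minimal re-cut 07:48:01Z; the only caller has level `3` from
`IsIsoPointTower 3 ν T pt`); the present binders (regular `S` of dimension `3`, `(u) = 𝔪_S`, `H`, `Y` excellent, level `3`) exclude
W1–W3 and are exactly what the retyped `HasVertexChainedTail` and the excellence of the first stage supply at the call site
`isoVertexTowersImpossible_of`.  Size M+ (content: the Hilbert–Samuel comparison between `y` and the generization cut out by the prime
over `(X̄, ū_a, ū_b)` — equimultiplicity of the hypersurface `h` along the regular curve `V(X, u_a, u_b)` versus isolation of `y`;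
Bennett / CJS Thm. 2.33-type input for a NON-closed point through the flat presentation, with excellence of `Y` available).  Why it
might fail: a further PRINTED binder of that type may be wanted (then it is added BY NAME, RULINGS v3.9-2 (F)); statement only, NOT
dealt as a prover object before triage (W4.2 DEAL «NOT DEALT THIS LINE»).  NOT a statement of any manuscript; OURS node (cf. CJS
LNM 2270 Lemma 1.37, Thm. 2.33 for the Hilbert–Samuel comparison); not a citation of print; not asserted. [OURS · L1 W4.2; AI-written] -/
def AlgIsolatedOfIsolated : Prop :=
  ∀ (Y : Scheme.{u}) [IsLocallyNoetherian Y], Scheme.IsExcellent Y → ∀ (y : Y), IsIsolatedInHSMaxLocus Y 3 y →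
    ∀ (S : Type) [CommRing S] [IsRegularLocalRing S] (u : Fin 3 → S) (h : S[X])
      [IsLocalRing (S[X] ⧸ Ideal.span {h})] (φ : (Y.presheaf.stalk y : Type u) →+* S[X] ⧸ Ideal.span {h}),
      ringKrullDim S = 3 → Ideal.span (Set.range u) = IsLocalRing.maximalIdeal S →
      (∀ (i : Fin 3) (T : Finset (Fin 3)), i ∉ T → ∀ y, u i * y ∈ Ideal.span (u '' ↑T) → y ∈ Ideal.span (u '' ↑T)) →
      IsLocalHom φ → φ.Flat → Ideal.map φ (IsLocalRing.maximalIdeal _) = IsLocalRing.maximalIdeal _ →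
      Function.Surjective ((IsLocalRing.residue _).comp φ) → h.Monic →
      ∀ a b : Fin 3, a ≠ b → h ∉ (Ideal.span ({X, C (u a), C (u b)} : Set S[X])) ^ h.natDegree

end Towers

/-! ## §4. The trichotomy of the kernel: T2 (vertex-recurrent, closed here modulo F + M-stubs) and T3 (translation-recurrent, OPEN) -/

section Assembly

open CategoryTheory AlgebraicGeometry TopologicalSpace
open Literature.AlgebraicGeometry.CossartJannsenSaito2020 Literature.AlgebraicGeometry.Resolution

universe u

/-- [OURS · C4 · T2 — RETYPED at landing] **ISO POINT TOWERS WITH A VERTEX-CHAINED TAIL DO NOT EXIST** (level `3`, any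
characteristic, any `ν`; no maximal-origin hypothesis; the first stage EXCELLENT — excellence then holds at every stage, blow-ups being
proper hence locally of finite type, and is what the retyped P1 consumes at level `3`; over a maximal origin it is automatic,
`isoQuadraticTowerTerminates_of_vertex_translation`; res-L1-w42-plan-1 RE-CUT OF RECORD 07:49:38Z: (R3) stands, the dimension being carried
by `HasVertexChainedTail`'s clause `ringKrullDim (S k) = 3`).
PROVED (module `…Corridor3WLadderForcedGameTowers`) from `IsoVertexChainImpossible` (⟸ `ForcedGameTerminates 3` ⟸
`SpivakovskyWinningStrategy 3`), `PairConditionOfAlgIsolated` (P2) and `AlgIsolatedOfIsolated` (P1): `isoVertexTowersImpossible_of`.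
NOT a statement of any manuscript; OURS node; not a citation of print; not asserted. [OURS · L1 W4.2; AI-written] -/
def IsoVertexTowersImpossible : Prop :=
  ∀ (ν : ℕ → ℕ) (T : BlowupTower.{u}) (pt : ∀ n, T.X n), Scheme.IsExcellent (T.X 0) →
    IsIsoPointTower 3 ν T pt → ¬ HasVertexChainedTail T pt

/-- [OURS · C4 · T3, THE RESIDUAL OPEN CORE] **ISO POINT TOWERS WITHOUT A VERTEX-CHAINED TAIL DO NOT EXIST over a maximal
origin of characteristic `p`**: an isolated E3 point tower in which, for every stage `n₀` and every `δ > 1` presentation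
chain started there, some later centre LEAVES the origin charts (a TRANSLATION event `u_j' = u_j/u_{j₀} − c_j`, or the initial
form becomes a `p`-th power, `δ = 1`) infinitely often.  This is where Moh's `z^{p^e} + f` jumping, Hauser's kangaroo points and
Cossart–Piltant's resolution of arithmetical threefolds live; the forced game gives the vertex runs for free, and isolation
constrains every translation event (pair condition before and after it) — whether that starves the kangaroo is the open bet
(census specimens to res-L1-w42-tri-1's batched job).  Why it might fail: an isolated-point kangaroo cycle in dimension 3 —
none is known; the printed divergent point sequences (Hauser–Perlega 2019, tree `HasDivergentPointBlowupSequence`) are in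
ambient dimension ≥ 5 and pass through non-isolated stages. (Pointers: CJS Rem. 6.29; Hauser–Perlega 2019 §4.) [cite: HauserPerlega2019, §4 (pointer)] -/
def IsoTranslationTowersImpossible (p : ℕ) : Prop :=
  ∀ (ν : ℕ → ℕ) (T : BlowupTower.{u}) (pt : ∀ n, T.X n), IsMaximalOrigin p 3 ν (T.X 0) (pt 0) →
    IsIsoPointTower 3 ν T pt → HasVertexChainedTail T pt

end Assembly

end Summit.ResolutionOfSingularities.ResolutionOfSingularities.Cruxes.SigmaMaxModifications.IdeasL1C4
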